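import Summits.HodgeConjecture.HodgeConjecture.Theorems.Q8SymplecticPowersRegularOfDenseBettiRegularMembers
import Literature.AlgebraicGeometry.HodgeTheory.QuaternionicQuarticDoublePlaneModel
import Literature.AlgebraicGeometry.HodgeTheory.QuaternionicQuarticDoublePlaneGenericity
import HarnessLib

/-!
# Route `Q8SymplecticPowers`, crux K1Q (stmt-HodgeConjecture-24190), line `mechanism-v2`: stub S1 `stub_regularVeryGeneralQ`
# RE-KEYED ONTO THE DOUBLE PLANE — «a dense set of parameters whose double plane `t² = s·α·ψ` has a regular smooth model»

Helper file (`--supports stmt-HodgeConjecture-24190 --as helper`; nothing here closes an item). Sorry-free; axioms standard; no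
definition; no named fact. Written by the prover seat `leafhand-hodge-q8symplecticpowers-4` (g4, eighth hand).

The tree's (Z_b) reduction `…RegularOfDenseBettiRegularMembers.stub_regularVeryGeneralQ_of_dense_bettiRegularMembers` asks, for a
Zariski-dense set of parameters `a`, for a smooth projective surface birational to the quartic fibre `𝒱_a` with `b₁ = 0`. The
double-plane bridge of this seat (`Literature/AlgebraicGeometry/HodgeTheory/QuaternionicQuarticDoublePlane{Chart,ChartEquiv,
Coordinates,Birational,Integral,SubstInjective,Model}`) identifies `𝒱_a` birationally with the affine DOUBLE PLANE
`Spec (DoublePlaneRing a)` : `t² = s·α·ψ` over the rational surface `{c = s²σc}` (≅ the `(s, σc)`-plane; Zariski's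
`z² = f(x, y)` with `(a₀ − a₁) f = s·y·(s² − 1)·ψ̃(s, y)`), at every complex parameter with `G_e(a) ≠ 0`, non-empty deck chart,
`a₀² ≠ a₁²`, `ψ(u₀, u₁, 1) ≠ 0` (`birationalOver_doublePlane_of_isHypersurfaceCutOutBy`). Hence S1 follows VERBATIM from

> **(Z_dp)** for every even `e ≥ 4` and every `0 ≠ g ∈ ℂ[a]` there is a parameter `a` with `g(a) ≠ 0`, `G_e(a) ≠ 0`, non-empty deck
> chart, `a₀² ≠ a₁²`, `ψ(u₀,u₁,1) ≠ 0`, and a smooth projective surface `X₀` birational over `ℂ` to the double plane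
> `Spec (DoublePlaneRing a)` with `b₁(X₀) = 0`

— the classical statement «the desingularised double plane `z² = f(x,y)` is REGULAR» for this branch curve (Zariski 1929; Naie 2007
Thm. 3.1: `q = Σ` superabundances, all zero here since the branch configuration `E + f₁ + … + f₄ + Ψ̃` imposes independent conditions),
which is the remaining print∕infrastructure input of S1 (memo ZB3-DOUBLE-PLANE-BRIDGE-leafhand4-g4, S1b + S1c).

* `birationalOver_fiberSch_doublePlane` — at a good complex parameter, `Spec (DoublePlaneRing a) ~bir 𝒱_a` over `ℂ`.
* `stub_regularVeryGeneralQ_of_dense_doublePlaneRegularMembers` — (Z_dp) → S1 VERBATIM.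

Honest scope: a reduction; S1, K1Q, HC are NOT proved here.
-/

set_option linter.dupNamespace false

noncomputable section

open CategoryTheory AlgebraicGeometry
open Literature.AlgebraicGeometry Literature.AlgebraicGeometry.Motives Literature.AlgebraicGeometry.HodgeTheory
open Literature.AlgebraicGeometry.HodgeTheory.BettiUniverse Literature.AlgebraicGeometry.HodgeTheory.Q8Family

namespace Summit.HodgeConjecture.HodgeConjecture.Theorems.Q8SymplecticPowersRegularOfDoublePlane

/-- **The good complex quartic fibre is birational to its double plane**: for `G_e(a) ≠ 0` (`e ≥ 2`), non-empty deck chart,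
`a₀² ≠ a₁²` and `ψ(u₀, u₁, 1) ≠ 0`, `Spec (DoublePlaneRing a) ~bir 𝒱_a = fiberSch e (eval a)` over `Spec ℂ`.
[cite: Zariski1929] [cite: Naie2007, §1.2 (normalization procedure) and Thm. 3.1] [cite: GortzWedhorn2020, Prop. 4.32 (2)] -/
theorem birationalOver_fiberSch_doublePlane {e : ℕ} (he : 2 ≤ e) (a : CIdx e → ℂ)
    (hGa : MvPolynomial.eval a (genericityElem e) ≠ 0) (hNT : Nontrivial (DeckRing a))
    (hdet : coefLin a 0 ^ 2 - coefLin a 1 ^ 2 ≠ 0) (hψ : ψ₂ a ≠ 0) :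
    AlgebraicGeometry.Scheme.BirationalOver (Spec.map (CommRingCat.ofHom (algebraMap ℂ (DoublePlaneRing a))))
      (fiberSch e (MvPolynomial.eval a)).hom := by
  have he1 : 1 ≤ e := le_trans (by norm_num) he
  have hcut := (Q8SymplecticPowersRegularOfDesingularization.exists_desingularization_fiberSch he a hGa).1
  have ha : (fun i => (MvPolynomial.eval a) (MvPolynomial.X i : ParamRing e)) = a := funext fun i => MvPolynomial.eval_X _
  haveI : Nontrivial (DeckRing (fun i => (MvPolynomial.eval a) (MvPolynomial.X i : ParamRing e))) := by rw [ha]; exact hNT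
  have key := birationalOver_doublePlane_of_isHypersurfaceCutOutBy e (MvPolynomial.eval a) he1 hGa
    (by rw [ha]; exact hdet) (by rw [ha]; exact hψ) (V := fiberSch e (MvPolynomial.eval a)) (by rw [ha]; exact hcut)
  rw [ha] at key
  exact key

/-- **S1 from a Zariski-dense set of parameters whose DOUBLE PLANE has a regular smooth model** ((Z_dp) of the module docstring →
the registered statement of S1 VERBATIM; = the tree's (Z_b) reduction composed with the double-plane bridge).
[cite: Zariski1929] [cite: Naie2007, Thm. 3.1] [cite: VoisinHodgeI2002, §9.1.1 Thm. 9.3] -/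
theorem stub_regularVeryGeneralQ_of_dense_doublePlaneRegularMembers
    (HDP : ∀ ⦃e : ℕ⦄, Even e → 4 ≤ e → ∀ g : ParamRing e, g ≠ 0 → ∃ a : CIdx e → ℂ, MvPolynomial.eval a g ≠ 0 ∧
      MvPolynomial.eval a (genericityElem e) ≠ 0 ∧ Nontrivial (DeckRing a) ∧ coefLin a 0 ^ 2 - coefLin a 1 ^ 2 ≠ 0 ∧
      ψ₂ a ≠ 0 ∧ ∃ (X₀ : SchemeOver ℂ) (_ : IsSmoothProjective 2 X₀),
        AlgebraicGeometry.Scheme.BirationalOver X₀.hom (Spec.map (CommRingCat.ofHom (algebraMap ℂ (DoublePlaneRing a)))) ∧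
          Module.finrank ℚ (bettiCohomology X₀ 1) = 0) :
open Literature.AlgebraicGeometry.Motives Literature.AlgebraicGeometry.HodgeTheory Literature.AlgebraicGeometry.HodgeTheory.BettiUniverse CategoryTheory.Limits in ∀ ⦃e : ℕ⦄, Even e → 4 ≤ e → ∃ G : ℕ → MvPolynomial ({d : Fin 3 →₀ ℕ // d.degree = 1} ⊕ {d : Fin 3 →₀ ℕ // d.degree = e - 1}) ℂ, (∀ i, ∃ c ψ : MvPolynomial (Fin 3) ℂ, c.IsHomogeneous 1 ∧ ψ.IsHomogeneous (e - 1) ∧ MvPolynomial.rename (Equiv.swap (0 : Fin 3) 1) ψ = ψ ∧ MvPolynomial.eval (Sum.elim (fun d => c.coeff d.1) (fun d => ψ.coeff d.1)) (G i) ≠ 0) ∧ ∀ c ψ : MvPolynomial (Fin 3) ℂ, c.IsHomogeneous 1 → ψ.IsHomogeneous (e - 1) → MvPolynomial.rename (Equiv.swap (0 : Fin 3) 1) ψ = ψ → (∀ i, MvPolynomial.eval (Sum.elim (fun d => c.coeff d.1) (fun d => ψ.coeff d.1)) (G i) ≠ 0) → ∀ ⦃V X : SchemeOver ℂ⦄ (hX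 : IsSmoothProjective 2 X), IsHypersurfaceCutOutBy 3 (MvPolynomial.X (Fin.last 3) ^ 4 * MvPolynomial.X (Fin.castSucc 2) ^ (2 * e) - MvPolynomial.rename Fin.castSucc (c * MvPolynomial.rename (Equiv.swap (0 : Fin 3) 1) c ^ 3 * ((MvPolynomial.X 0 - MvPolynomial.X 1) * ψ) ^ 2)) V → AlgebraicGeometry.Scheme.BirationalOver X.hom V.hom → Module.finrank ℚ (bettiCohomology X 1) = 0 := by
  refine Q8SymplecticPowersRegularOfDenseBettiRegularMembers.stub_regularVeryGeneralQ_of_dense_bettiRegularMembers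
    fun e he h4 g hg => ?_
  obtain ⟨a, hga, hGa, hNT, hdet, hψ, X₀, hX₀, hbir, hb⟩ := HDP he h4 g hg
  have he2 : 2 ≤ e := le_trans (by norm_num) h4
  exact ⟨a, hga, hGa, X₀, hX₀, hbir.trans (birationalOver_fiberSch_doublePlane he2 a hGa hNT hdet hψ), hb⟩

/-! ### Appended (same seat): the side conditions absorbed into ONE genericity element -/

/-- **S1 from a Zariski-dense set of parameters whose double plane has a regular smooth model — clean form (Z_dp′).** If for
every even `e ≥ 4` and every `0 ≠ g ∈ ℂ[a]` some parameter `a` with `g(a) ≠ 0` carries a smooth projective surface birational over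
`ℂ` to the double plane `Spec (DoublePlaneRing a)` (`t² = s·α·ψ` over `{c = s²σc}`) with `b₁ = 0`, then the registered statement
of S1 holds VERBATIM. (The side conditions `G_e(a) ≠ 0`, non-empty deck chart, `a₀² ≠ a₁²`, `ψ(u₀,u₁,1) ≠ 0` of (Z_dp) are absorbed
by replacing `g` with `g · G_e · (a₀ + a₁)`, `Q8Family.doublePlaneGenericityElem`.) The hypothesis is Zariski's regularity of the
desingularised double plane `z² = f(x, y)` for the census branch curve — S1's residue in print (Naie 2007 Thm. 3.1).
[cite: Zariski1929] [cite: Naie2007, Thm. 3.1] [cite: VoisinHodgeI2002, §9.1.1 Thm. 9.3] -/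
theorem stub_regularVeryGeneralQ_of_dense_doublePlaneRegular
    (HDP : ∀ ⦃e : ℕ⦄, Even e → 4 ≤ e → ∀ g : ParamRing e, g ≠ 0 → ∃ a : CIdx e → ℂ, MvPolynomial.eval a g ≠ 0 ∧
      ∃ (X₀ : SchemeOver ℂ) (_ : IsSmoothProjective 2 X₀),
        AlgebraicGeometry.Scheme.BirationalOver X₀.hom (Spec.map (CommRingCat.ofHom (algebraMap ℂ (DoublePlaneRing a)))) ∧
          Module.finrank ℚ (bettiCohomology X₀ 1) = 0) :
open Literature.AlgebraicGeometry.Motives Literature.AlgebraicGeometry.HodgeTheory Literature.AlgebraicGeometry.HodgeTheory.BettiUniverse CategoryTheory.Limits in ∀ ⦃e : ℕ⦄, Even e → 4 ≤ e → ∃ G : ℕ → MvPolynomial ({d : Fin 3 →₀ ℕ // d.degree = 1} ⊕ {d : Fin 3 →₀ ℕ // d.degree = e - 1}) ℂ, (∀ i, ∃ c ψ : MvPolynomial (Fin 3) ℂ, c.IsHomogeneous 1 ∧ ψ.IsHomogeneous (e - 1) ∧ MvPolynomial.rename (Equiv.swap (0 : Fin 3) 1) ψ = ψ ∧ MvPolynomial.eval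 (Sum.elim (fun d => c.coeff d.1) (fun d => ψ.coeff d.1)) (G i) ≠ 0) ∧ ∀ c ψ : MvPolynomial (Fin 3) ℂ, c.IsHomogeneous 1 → ψ.IsHomogeneous (e - 1) → MvPolynomial.rename (Equiv.swap (0 : Fin 3) 1) ψ = ψ → (∀ i, MvPolynomial.eval (Sum.elim (fun d => c.coeff d.1) (fun d => ψ.coeff d.1)) (G i) ≠ 0) → ∀ ⦃V X : SchemeOver ℂ⦄ (hX : IsSmoothProjective 2 X), IsHypersurfaceCutOutBy 3 (MvPolynomial.X (Fin.last 3) ^ 4 * MvPolynomial.X (Fin.castSucc 2) ^ (2 * e) - MvPolynomial.rename Fin.castSucc (c * MvPolynomial.rename (Equiv.swap (0 : Fin 3) 1) c ^ 3 * ((MvPolynomial.X 0 - MvPolynomial.X 1) * ψ) ^ 2)) V → AlgebraicGeometry.Scheme.BirationalOver X.hom V.hom → Module.finrank ℚ (bettiCohomology X 1) = 0 := by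
  refine stub_regularVeryGeneralQ_of_dense_doublePlaneRegularMembers fun e he h4 g hg => ?_
  have he2 : 2 ≤ e := le_trans (by norm_num) h4
  have hg' : g * doublePlaneGenericityElem e ≠ 0 := mul_ne_zero hg (doublePlaneGenericityElem_ne_zero e he2)
  obtain ⟨a, hga', X₀, hX₀, hbir, hb⟩ := HDP he h4 _ hg'
  rw [map_mul, mul_ne_zero_iff] at hga'
  obtain ⟨hga, hg0⟩ := hga'
  have ha : (fun i => (MvPolynomial.eval a) (MvPolynomial.X i : ParamRing e)) = a := funext fun i => MvPolynomial.eval_X _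
  obtain ⟨hG, hdet, hψ⟩ := genericity_of_eval_ne_zero (MvPolynomial.eval a) hg0
  have hdet' : coefLin a 0 ^ 2 - coefLin a 1 ^ 2 ≠ 0 := by rw [← ha]; exact hdet
  have hψ' : ψ₂ a ≠ 0 := by rw [← ha]; exact hψ
  exact ⟨a, hga, hG, nontrivial_deckRing_of_field a hdet' hψ', hdet', hψ', X₀, hX₀, hbir, hb⟩

end Summit.HodgeConjecture.HodgeConjecture.Theorems.Q8SymplecticPowersRegularOfDoublePlane

end
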